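import Literature.MathematicalPhysics.QuantumFieldTheory.Balaban1983to89.TreeLengthTorus
import Literature.MathematicalPhysics.QuantumFieldTheory.Balaban1983to89.B10Eq24Cumulant
import Literature.MathematicalPhysics.QuantumFieldTheory.Balaban1983to89.B10LargeField
import Literature.MathematicalPhysics.QuantumFieldTheory.Balaban1985CMP102.Binders
import Summits.QuantumFields.Balaban3D.Carriers.Pieces
import Summits.QuantumFields.Balaban3D.Carriers.OldTerms

/-!
# Lane `pub-balaban3d` — carrier layer p1 (`Carriers.StepSeries`): the EXPANSION DATA of one step as a record (`StepSeries`, the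
# «SeriesData» of rulings R-PIECES (d) / R-CUBE / R-ACT / R-FL v1) and the step pieces DEFINED from it — activities through the
# chart (R-29), retained sums (59), previous-scale sums, the fluctuation-integral logarithm (58) as an honest `log ∫ exp`, the
# Gaussian representations (63) of `log Z^{(k)}` — with the interaction sum `Pint` and the vacuum-energy profile `E^{(k)}` (62)
# DEFINED so that LQB's leaves `PintSucc`, `Estep62`, `NoInteraction0` hold BY `rfl`

R-FL (lane STATUS 2026-08-22T00:40:46Z): the eleven analytic pieces split into (i) GENUINE EXPANSION DATA — here the fields of
`StepSeries` (chart family Ψ and background chart configurations B of (27)–(29) on LQB's torus block carrier `TreeLengthTorus.tsys 3 N`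
(R-CUBE) with the chart space PINNED to `PBond S.P k → V` (v1.3, R-32′), the far terms of G3D-06, the new polymer sums `PY`/`PYZ` of (33)/(60)–(61) (seat p6 identifies
them with its jet formula), the previous-scale terms 𝒫_j(Y_j, U_{k+1}) indexed by (43)'s `Y_j = (y, c₁, …, c_n)` over the concrete index geometry of
`Carriers.OldTerms` (v1.1), the G3D-02 graph carrier `Gt` (v1.1), the fluctuation measure/box/potential of (58) (seat p5's
D-p5-2), the (63)-representation data (precision matrices + Jacobian constants) of `log Z^{(k)}(Λ, U)` (G3D-04/05)) — and (ii) DEFINED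
pieces (`StepSeries.act/PprU/Ppr1/PprT/Pold/PoldIn/logFl/logZU/logZ1/logZT`).  NO analytic piece is a free real at E4: the referee
audits by `#print`-ing `StepSeries.toStepData`.  (α)-DISPLAYS about the data ((25) via G3D-01, (28), (32), (44)–(45), positivity (54),
G3D-02/04/05/06) stay END HYPOTHESES (R-DISP) and are NOT fields.  [folklore] bookkeeping; nothing of CMP 102 is asserted.
-/

open MeasureTheory Finset
open scoped Matrix

namespace Summit.QuantumFields.Balaban3D.Carriers

open Literature.MathematicalPhysics.QuantumFieldTheory.Balaban1983to89
open Literature.MathematicalPhysics.QuantumFieldTheory.Balaban1983to89.TreeLengthTorus (tsys TPt)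
open Literature.MathematicalPhysics.QuantumFieldTheory.Balaban1985CMP102
open Literature.MathematicalPhysics.QuantumFieldTheory.Balaban1985CMP102.Setting

variable {L : ℕ} {S : Scales L} {G : Type} [GaugeGroup G] [MeasurableSpace G] [HaarData G]

/-! ## §1 The expansion data of the step `k → k+1` -/

/-- THE EXPANSION DATA of the step `k → k+1` (R-FL (i)), over the histories `Hist S.P (k+1)` and coarse fields `GaugeField S.P (k+1) G`,
PARAMETRISED (v1.3, rulings R-32′ / R-OMEGA) by the chart-value space `V` (a complex normed space; the END THEOREM takes `V := 𝔤ᶜ` of the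
group model = seat p4's `GroupModelLieC.lieC 𝔊.M`, so that the detecting property of (26)⇒(32) is a lane theorem and no chart space is
quantified) and by the number `N` of big blocks per direction of the unit lattice `T^{(k)}` (the END THEOREM takes `N := nblkOf S K k`):
* localization domains `X : (tsys 3 N).Dom` (R-CUBE); THE CHART SPACE IS PINNED: `E := PBond S.P k → V` (𝓗 = one `V`-value per positively
  oriented bond of `T^{(k)}`; p. 263 L25–28, p. 271 L1–3 «the same chart B»);
* chart data (27)–(29): charts `Ψ X : E → ℂ` (pull-back of `𝒫′_{k+1}(g_k, X, ·)`), background chart configurations `Bcfg X h U` (the `B_k(c)`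
  of (27)/(43) at `U_{k+1}(h, U)`), the far terms `far` of G3D-06 — the blocks of `Ω_{k+1}(h)` and the retained radius are NOT fields
  (R-OMEGA: `Carriers.OldTerms.ΩblkOf`, `TowerBase.Rret := rretOf`);
* the new polymer sums `PY h U = Σ_{Y_{k+1}} 𝒫_{k+1}(g_k, Y_{k+1}, U_{k+1})` of (33)/(60) and `PYZ` of the decomposition (61) (data;
  seat p6 identifies them with its chart-jet formula);
* previous-scale terms `oldVal h U j y n c = 𝒫_j((y, c), U_{k+1}(h, U))`, `1 ≤ j ≤ k`, over the (43) index geometry of `Carriers.OldTerms`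
  (blocks in `Ω_k`, admissible bonds, dropped terms «Y_j ⊄ Ω_{k+1}»), degrees `n ≤ Ndeg j`; the G3D-02 graph carrier `Gt h`;
* the fluctuation integral of (58): space `Fl`, Gaussian measure `μ` (= the normalised `dμ_{C^{(k)}}` of (53)–(55), R-324), small-field
  box `box h` (the `χ` of (58)), effective potential `𝒱 h U` ((56)–(57) are displays ABOUT it);
* the representation (63) of `log Z^{(k)}(Λ, U) = J + log ∫ exp(−½⟨v, Q v⟩)dv` at `(B(Λ_{k+1}), U_{k+1})`, `(B(Λ_{k+1}), 1)`, `(T₁^{(k)}, 1)`.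
[cite: Balaban1985UV3, (55)–(63) pp.269–272] -/
structure StepSeries {L : ℕ} (S : Scales L) (G : Type) [GaugeGroup G] [MeasurableSpace G] [HaarData G]
    (V : Type) [NormedAddCommGroup V] [NormedSpace ℂ V] (N : ℕ) [NeZero N] (k : ℕ) : Type 1 where
  /-- charts `Ψ_X = 𝒫′_{k+1}(g_k, X, exp iη𝓗(·))` on `𝓗 : PBond S.P k → V` ((29) p. 263) -/
  Ψ : (tsys 3 N).Dom → (PBond S.P k → V) → ℂ
  /-- background chart configurations `B(h, U)` restricted to `X` ((27) p. 263 / (43) p. 266) -/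
  Bcfg : (tsys 3 N).Dom → Hist S.P (k + 1) → GaugeField S.P (k + 1) G → (PBond S.P k → V)
  /-- far terms (G3D-06, p. 264 L15–16) -/
  far : (tsys 3 N).Dom → Hist S.P (k + 1) → GaugeField S.P (k + 1) G → ℝ
  /-- `Σ_{Y_{k+1}} 𝒫_{k+1}(g_k, Y_{k+1}, U_{k+1})` of (33)/(60) -/
  PY : Hist S.P (k + 1) → GaugeField S.P (k + 1) G → ℝ
  /-- the same from the decomposition (61) of `log Z^{(k)}(·,U_{k+1}) − log Z^{(k)}(·,1)` -/
  PYZ : Hist S.P (k + 1) → GaugeField S.P (k + 1) G → ℝ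
  /-- THE G3D-02 CARRIER (v1.1; seat p5 / lead batch 13 (d)): the graph/walk-labelled expressions of the sixth-order cumulant
  calculation of (58) per history («Lower order terms are represented by graphs …», p. 270 L22–24; p. 262 L1–22 at the first step),
  typed by the spine's `Binders.GraphTerms` over the block carrier.  DATA; the binder `Binders.GraphRep23AsCited (Gt h) cum …` and the
  identification of its activities with `act h` (R-ACT, ONE identification `hact`) are (α) END HYPOTHESES of the leaves, not fields. -/
  Gt : Hist S.P (k + 1) → Binders.GraphTerms (tsys 3 N) (GaugeField S.P (k + 1) G)
  /-- degree cutoff of the previous-scale terms kept explicitly at old scale `j` (v1.1; higher degrees sit in the remainder, (57) p. 270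
  «we estimate terms with an overall power greater than six as above») -/
  Ndeg : ℕ → ℕ
  /-- THE PREVIOUS-SCALE TERMS (v1.1, (y;c)-indexed as printed in (43) p. 266 — seat p5's row C10): `oldVal h U j y n c =
  𝒫_j((y, c₁, …, c_n), U_{k+1}(h, U))`, the signed value of the old term of scale `j`, block `y`, bonds `c`, at the composite
  minimizer; the INDEX SET (blocks in `Ω_k`, admissible bonds, dropped terms) is the concrete geometry of `Carriers.OldTerms` -/
  oldVal : Hist S.P (k + 1) → GaugeField S.P (k + 1) G → (j : ℕ) → Site S.P j → (n : ℕ) → (Fin n → PBond S.P j) → ℝ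
  /-- the fluctuation-variable space of (58) -/
  Fl : Type
  /-- its measurable structure -/
  [instFl : MeasurableSpace Fl]
  /-- the Gaussian measure `dμ_{C^{(k)}}` -/
  μ : Measure Fl
  /-- the small-field box `χ` of (58), per history -/
  box : Hist S.P (k + 1) → Set Fl
  /-- the effective potential `𝒱_k` of (58) -/
  𝒱 : Hist S.P (k + 1) → GaugeField S.P (k + 1) G → Fl → ℝ
  /-- number of Gaussian variables of `Z^{(k)}(B(Λ_{k+1}), ·)` per history -/
  dimZ : Hist S.P (k + 1) → ℕ
  /-- precision matrix of (63) at `(B(Λ_{k+1}), U_{k+1})` -/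
  QU : (h : Hist S.P (k + 1)) → GaugeField S.P (k + 1) G → Matrix (Fin (dimZ h)) (Fin (dimZ h)) ℝ
  /-- Jacobian constant at `(B(Λ_{k+1}), U_{k+1})` -/
  JU : Hist S.P (k + 1) → GaugeField S.P (k + 1) G → ℝ
  /-- precision matrix at `(B(Λ_{k+1}), 1)` -/
  Q1 : (h : Hist S.P (k + 1)) → Matrix (Fin (dimZ h)) (Fin (dimZ h)) ℝ
  /-- Jacobian constant at `(B(Λ_{k+1}), 1)` -/
  J1 : Hist S.P (k + 1) → ℝ
  /-- number of Gaussian variables of `Z^{(k)}(T₁^{(k)}, 1)` -/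
  dimT : ℕ
  /-- precision matrix at `(T₁^{(k)}, 1)` -/
  QT : Matrix (Fin dimT) (Fin dimT) ℝ
  /-- Jacobian constant at `(T₁^{(k)}, 1)` -/
  JT : ℝ

namespace StepSeries

variable {V : Type} [NormedAddCommGroup V] [NormedSpace ℂ V] {N : ℕ} [NeZero N] {k : ℕ}

/-- The measurable structure of the fluctuation-variable space `Fl` (the record's field `instFl`, made available to instance
resolution as a declared instance — same term as registering the projection). [folklore] -/
instance instMeasurableSpaceFl (𝔖 : StepSeries S G V N k) : MeasurableSpace 𝔖.Fl := 𝔖.instFl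

variable (𝔖 : StepSeries S G V N k)

/-- The number of big blocks per direction (the parameter `N`; kept as a projection so that `(𝔖 k).Nblk` reads as before). [folklore] -/
abbrev Nblk (_𝔖 : StepSeries S G V N k) : ℕ := N

/-- THE PINNED CHART SPACE `E = (PBond S.P k → V)` (ruling R-32′; kept as a projection so that `(𝔖 k).E` reads as before — finite-dimensional
as soon as `V` is). [cite: Balaban1985UV3, (29) p.263] -/
abbrev E (_𝔖 : StepSeries S G V N k) : Type := PBond S.P k → V

/-! ## §2 The DEFINED pieces (R-FL (ii), R-ACT, R-29) -/

/-- R-29 / R-ACT: THE real activity of the domain `X` at history `h` and field `U`, DEFINED through the chart: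
`𝒫′_{k+1}(g_k, X, U_{k+1}) := Re Ψ_X(B_X(h, U))`. [cite: Balaban1985UV3, (29) p.263] -/
def act (h : Hist S.P (k + 1)) (X : (tsys 3 N).Dom) (U : GaugeField S.P (k + 1) G) : ℝ := (𝔖.Ψ X (𝔖.Bcfg X h U)).re

/-- The RETAINED localizations of (59) p. 270 L33–37: `X ⊂ Ω_{k+1}(h)` (all blocks of `X` among the big blocks `Ωb h` of `B(Λ_{k+1}(h))` —
R-OMEGA: the tower supplies `Ωb := ΩblkOf M₁ Rcol N`) and `𝓛(X) < Rret` (the retained radius of reading D-RET — R-OMEGA: the tower supplies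
`Rret := rretOf S K k = R₁ r(g_k)`, 𝓛 counting `M₁`-blocks; the rest are the `O(g_k)|Z_k|` and `O((L^kε)^{3+κ₀})|T|` terms).  Decidability by
inference (no classical wrapper), so that consumers' `univ.filter` statements agree by `rfl`. [cite: Balaban1985UV3, (59) p.270] -/
noncomputable def loc (_𝔖 : StepSeries S G V N k) (Ωb : Hist S.P (k + 1) → Finset (TPt 3 N)) (Rret : ℝ) (h : Hist S.P (k + 1)) :
    Finset (tsys 3 N).Dom :=
  Finset.univ.filter fun X => X.1 ⊆ Ωb h ∧ (tsys 3 N).dj X < Rret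

/-- `PprU h U = Σ_{X retained} 𝒫′_{k+1}(g_k, X, U_{k+1})` ((55)/(59)). [cite: Balaban1985UV3, (59) p.270] -/
noncomputable def PprU (Ωb : Hist S.P (k + 1) → Finset (TPt 3 N)) (Rret : ℝ) (h : Hist S.P (k + 1)) (U : GaugeField S.P (k + 1) G) : ℝ :=
  ∑ X ∈ 𝔖.loc Ωb Rret h, 𝔖.act h X U

/-- `Ppr1 h = Σ_{X retained} 𝒫′_{k+1}(g_k, X, 1)` — the chart at `𝓗 = 0` ((60)–(62)). [cite: Balaban1985UV3, (60) p.271] -/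
noncomputable def Ppr1 (Ωb : Hist S.P (k + 1) → Finset (TPt 3 N)) (Rret : ℝ) (h : Hist S.P (k + 1)) : ℝ :=
  ∑ X ∈ 𝔖.loc Ωb Rret h, (𝔖.Ψ X 0).re

/-- `PprT = Σ_X 𝒫′_{k+1}(g_k, X, 1)` over ALL domains of the torus (the term of `E^{(k)}`, (62)). [cite: Balaban1985UV3, (62) p.271] -/
noncomputable def PprT : ℝ := ∑ X : (tsys 3 N).Dom, (𝔖.Ψ X 0).re

/-- `Pold h U = Σ_{j=1}^{k} Σ_{Y_j} 𝒫_j(Y_j, U_{k+1})`, ALL terms of the (43) index set ((58) p. 270): blocks `y ∈ Ω_k^{(j)} ∩ M₁L^jηZ³`, bonds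
`c_i ⊂ Ω_k^{(j)}` with `|c_{i,−} − y| < Rcol j`, degrees `n ≤ Ndeg j` (`Carriers.OldTerms.oldSum`; the shape `hPold` of seat p5's
`abs_pold_sub_poldIn_le` BY `rfl`).  The big-block size `M₁` and collar profile `Rcol` are the tower's. [cite: Balaban1985UV3, (43) p.266 + (58) p.270] -/
noncomputable def Pold (M₁ : ℕ) (Rcol : ℕ → ℕ) (h : Hist S.P (k + 1)) (U : GaugeField S.P (k + 1) G) : ℝ :=
  oldSum M₁ Rcol 𝔖.Ndeg (fun h j y n c => 𝔖.oldVal h U j y n c) h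

/-- `PoldIn h U` = the same sum with the terms «Y_j not contained in Ω_{k+1}(h)» replaced by `0` (p. 272 L29–31; `Carriers.OldTerms.oldSumIn`,
the shape `hPoldIn` of seat p5's `abs_pold_sub_poldIn_le` BY `rfl`). [cite: Balaban1985UV3, p.272 L29–31] -/
noncomputable def PoldIn (M₁ : ℕ) (Rcol : ℕ → ℕ) (h : Hist S.P (k + 1)) (U : GaugeField S.P (k + 1) G) : ℝ :=
  oldSumIn M₁ Rcol 𝔖.Ndeg (fun h j y n c => 𝔖.oldVal h U j y n c) h

/-- **`logFl h U := log ∫_{box} exp(𝒱_k(h,U,ω)) dμ_{C^{(k)}}(ω)`** — the fluctuation integral of (58) p. 270 as an honest integral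
(seat p5's reading D-p5-2: (3.24)/(58) are then THEOREMS about exactly this number). [cite: Balaban1985UV3, (58) p.270] -/
noncomputable def logFl (h : Hist S.P (k + 1)) (U : GaugeField S.P (k + 1) G) : ℝ :=
  Real.log (∫ ω in 𝔖.box h, Real.exp (𝔖.𝒱 h U ω) ∂𝔖.μ)

/-- **THE PRINTED CUMULANTS DEFINED** (v1.1, ruling R-324 / seat p5's `cumulant58_series_self`): `cum h U n := ⟨𝒱_k(h,U,·)ⁿ⟩ᵀ`, the
n-th truncated expectation of the box-restricted law `χ·dμ^{(k)}` (LQB `B10Eq24Cumulant.truncExp`/`chiMeasure`) — so the re-expansion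
input (b) of [B1] (3.24) vanishes identically and G3D-02 speaks about THESE numbers. [cite: Balaban1985UV3, (58) p.270; Balaban1982Higgs1, (3.24) p.616] -/
noncomputable def cum (h : Hist S.P (k + 1)) (U : GaugeField S.P (k + 1) G) (n : ℕ) : ℝ :=
  B10Eq24Cumulant.truncExp (𝔖.𝒱 h U) (B10Eq24Cumulant.chiMeasure 𝔖.μ ((𝔖.box h).indicator fun _ => (1 : ℝ))) n

/-- The Gaussian logarithm `log ∫_{ℝⁿ} exp(−½⟨v, Qv⟩) dv` of (63). [cite: Balaban1985UV3, (63) p.272] -/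
noncomputable def gaussLog {n : ℕ} (Q : Matrix (Fin n) (Fin n) ℝ) : ℝ :=
  Real.log (∫ v : Fin n → ℝ, Real.exp (-(1 / 2 : ℝ) * (v ⬝ᵥ Q.mulVec v)))

/-- `logZU h U := log Z^{(k)}(B(Λ_{k+1}), U_{k+1}) = J + log ∫ exp(−½⟨v, Q v⟩)` ((63); (55) p. 269). [cite: Balaban1985UV3, (63) p.272] -/
noncomputable def logZU (h : Hist S.P (k + 1)) (U : GaugeField S.P (k + 1) G) : ℝ := 𝔖.JU h U + gaussLog (𝔖.QU h U)

/-- `logZ1 h := log Z^{(k)}(B(Λ_{k+1}), 1)` ((61) p. 271). [cite: Balaban1985UV3, (61) p.271] -/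
noncomputable def logZ1 (h : Hist S.P (k + 1)) : ℝ := 𝔖.J1 h + gaussLog (𝔖.Q1 h)

/-- `logZT := log Z^{(k)}(T₁^{(k)}, 1)` ((62) p. 271). [cite: Balaban1985UV3, (62) p.271] -/
noncomputable def logZT : ℝ := 𝔖.JT + gaussLog 𝔖.QT

/-- THE MAP `StepSeries → StepData` the referee `#print`s (R-FL): every analytic piece is a Finset sum / a `log ∫` over the data, except
`PY`, `PYZ` (data of (33)/(60)–(61), identified by seat p6's chart-jet theorem); the tower supplies its big-block size `M₁`, collar profile
`Rcol` (the (43) index geometry and the blocks `ΩblkOf` of `B(Λ_{k+1})`, R-OMEGA) and retained radius `Rret` (R-OMEGA). [cite: Balaban1985UV3, (55)–(63) pp.269–272] -/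
noncomputable def toStepData (M₁ : ℕ) (Rcol : ℕ → ℕ) (Rret : ℝ) : StepData S G k where
  logZU := 𝔖.logZU
  logZ1 := 𝔖.logZ1
  logZT := 𝔖.logZT
  logFl := 𝔖.logFl
  PprU := 𝔖.PprU (ΩblkOf M₁ Rcol N) Rret
  Ppr1 := 𝔖.Ppr1 (ΩblkOf M₁ Rcol N) Rret
  PprT := 𝔖.PprT
  PY := 𝔖.PY
  PYZ := 𝔖.PYZ
  Pold := 𝔖.Pold M₁ Rcol
  PoldIn := 𝔖.PoldIn M₁ Rcol

end StepSeries

/-! ## §3 The tower over a series: `Pint` and `E^{(k)}` DEFINED, the leaves `NoInteraction0`/`PintSucc`/`Estep62` by `rfl` -/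

section TowerOfSeries

variable {V : Type} [NormedAddCommGroup V] [NormedSpace ℂ V] {Nc : ℕ → ℕ} [∀ k, NeZero (Nc k)]

/-- **(43)/(36)/(41) interaction sum DEFINED by the step recursion**: `Pint 0 = 0` (no interaction in ρ₀, (1)); `Pint (k+1) h U =
PoldIn_k h U + PY_k h U + PYZ_k h U` — exactly LQB's `PintSucc` identification (p. 265 / p. 266). [cite: Balaban1985UV3, (43) p.266] -/
noncomputable def pintOfSeries (M₁ : ℕ) (Rcol : ℕ → ℕ) (𝔖 : ∀ k, StepSeries S G V (Nc k) k) :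
    (k : ℕ) → Hist S.P k → GaugeField S.P k G → ℝ
  | 0, _, _ => 0
  | k + 1, h, U => (𝔖 k).PoldIn M₁ Rcol h U + (𝔖 k).PY h U + (𝔖 k).PYZ h U

/-- **(62) vacuum-energy profile DEFINED**: `E^{(k)} = (log σ₀ + d(𝔤) log g_k)|T₁^{(k)*}| + log Z^{(k)}(T₁^{(k)}, 1) + Σ_X 𝒫′_{k+1}(g_k, X, 1)`
(ruling R-E; LQB `Estep62`). [cite: Balaban1985UV3, (62) p.271] -/
noncomputable def estepOfSeries (𝔖 : ∀ k, StepSeries S G V (Nc k) k) (C : ∀ k, PiecesParams S k) (k : ℕ) : ℝ :=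
  ((C k).logσ₀ + (C k).dg * Real.log (S.gk k)) * (C k).starT + (𝔖 k).logZT + (𝔖 k).PprT

end TowerOfSeries

/-- THE TOWER INPUT WITHOUT ITS EXPANSION SUMS AND BARRIERS: everything of `TowerInput` except `Pint`, `Estep` (which a series DEFINES, R-FL) and
the R-RN barriers `lower`/`upper` (which `Carriers.Series` DEFINES as the printed step bounds, v1.2); plus the retained-radius profile `Rret`
(R-OMEGA). [folklore] -/
structure TowerBase {L : ℕ} (S : Scales L) (G : Type) [GaugeGroup G] [MeasurableSpace G] [HaarData G] where
  /-- see `TowerInput` -/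
  ε₁ : ℕ → ℝ
  /-- see `TowerInput` -/
  av : ∀ j, Averaging S.P j G
  /-- see `TowerInput` -/
  avgAC : ∀ j, AvgAC (av j).avg
  /-- see `TowerInput` -/
  reg : ℕ → Set (GaugeField S.P 0 G)
  /-- see `TowerInput` -/
  Uk : (k : ℕ) → GaugeField S.P (k + 1) G → GaugeField S.P 0 G
  /-- see `TowerInput` -/
  M₁ : ℕ
  /-- see `TowerInput` -/
  Rcol : ℕ → ℕ
  /-- the retained-radius profile of (59) (reading D-RET; R-OMEGA: `rretOf S K k = R₁ r(g_k)` in the standard tower) -/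
  Rret : ℕ → ℝ
  /-- see `TowerInput` -/
  b₀ : ℝ
  /-- see `TowerInput` -/
  p₀ : ℝ
  /-- see `TowerInput` -/
  κ₀ : ℝ
  /-- see `TowerInput` -/
  W : HistWeights S.P G
  /-- see `TowerInput` -/
  UkH : (k : ℕ) → Hist S.P k → GaugeField S.P k G → GaugeField S.P 0 G
  /-- see `TowerInput` -/
  UkH_triv : ∀ (k : ℕ) (V : GaugeField S.P k G), UkH k (Hist.triv S.P k) V = ukAll Uk k V
  /-- see `TowerInput` -/
  zcoef : ℕ → ℝ
  /-- see `TowerInput` -/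
  rcoef : ℕ → ℝ

end Summit.QuantumFields.Balaban3D.Carriers
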